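import Literature.NumberTheory.Automorphic.HeckeTransversalGL
import Summits.HodgeConjecture.HodgeConjecture.Theorems.K2LiuCartanSeriesGL2
import Literature.NumberTheory.Automorphic.HeckeGelfandTrick

/-!
# Preliminaries for the unramified doubling Hecke identity (socket #28s of hLiu418's LOCAL SEAM of s23)

Track B ∕ K2-LIT, hLiu418 = stmt-HodgeConjecture-24832; helper (count-neutral) for ★ `K2LiuUnramifiedDoublingHeckeIdentity`
(#28s `sig_K2LiuUnramifiedDoublingHeckeIdentity`). Small generic facts, kept apart to respect the 400-line rule:

* `valuation_det_map_eq_one` — a matrix integral together with its inverse (after a ring map into a valued field) has unit determinant;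
* `orbit_mk_mul_eq_image` — translating by an element commuting with `K` maps `K`-orbits of cosets bijectively;
* `ofReal_inv_pow_cpow` — `((q⁻¹)^N)^z = (q^{−z})^N` for a positive integer base;
* `apply_zpow_eq_smul` — `τ(g) u = b u`, `u ≠ 0` ⟹ `b ≠ 0` and `τ(g^j) u = b^j u` for all `j ∈ ℤ` (a monoid hom into bounded operators);
* `exists_antitoneEquiv` — the Cartan lattice of `GL₂` (antitone pairs) is `ℕ × ℤ`; `summable_cartan_bound` — `∑ q^{a₀−a₁} ρ^{|a₀|+|a₁|} < ∞`
  for `qρ < 1` (three cones of ★ `K2LiuCartanSeriesGL2.exists_coneEquiv`), the convergence majorant of the doubling Hecke operator.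

[Li1992, §3]; [Macdonald1995, Ch. V §2]; [CasselsFrohlichANT1967, Ch. II §10, Ch. XV §4.3]. Theorems only; no `sorry`.
HONEST LABEL: HC_CM is proved only modulo the printed citations (2 remaining named inputs: hLiu418 = stmt-HodgeConjecture-24832, h413 =
stmt-HodgeConjecture-24833) until rung 0 closes; this file is unconditional and moves no counter.
-/

set_option autoImplicit false

set_option linter.dupNamespace false

noncomputable section

open scoped Matrix Pointwise
open Matrix MulAction ValuativeRel

namespace Summit.HodgeConjecture.HodgeConjecture.Cruxes.HLiu418.K2LiuUnramifiedDoublingHeckePrelims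

open Literature.NumberTheory.Automorphic

/-! ## §1 Preliminaries -/

/-- the determinant of a matrix that is integral together with its inverse (after a ring map into a valued field) has valuation `1`.
[cite: CasselsFrohlichANT1967, Ch. II §10] -/
theorem valuation_det_map_eq_one {R : Type*} [Field R] {F : Type*} [Field F] [ValuativeRel F] {m : ℕ} (ψ : R →+* F)
    {T : Matrix (Fin m) (Fin m) R} (hT : IsUnit T.det) (h : ∀ i j, valuation F (ψ (T i j)) ≤ 1)
    (hinv : ∀ i j, valuation F (ψ (T⁻¹ i j)) ≤ 1) : valuation F (T.map ψ).det = 1 := by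
  have h1 : valuation F (T.map ψ).det ≤ 1 :=
    (Valuation.mem_integer_iff _ _).1 (IsIntegralMatrix.det_mem fun i j => (Valuation.mem_integer_iff _ _).2 (h i j))
  have h2 : valuation F (T⁻¹.map ψ).det ≤ 1 :=
    (Valuation.mem_integer_iff _ _).1 (IsIntegralMatrix.det_mem fun i j => (Valuation.mem_integer_iff _ _).2 (hinv i j))
  have hprod : (T.map ψ).det * (T⁻¹.map ψ).det = 1 := by
    rw [← Matrix.det_mul, ← Matrix.map_mul, Matrix.mul_nonsing_inv _ hT, Matrix.map_one ψ (map_zero ψ) (map_one ψ), Matrix.det_one]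
  have hv : valuation F (T.map ψ).det * valuation F (T⁻¹.map ψ).det = 1 := by rw [← map_mul, hprod, map_one]
  refine le_antisymm h1 ?_
  by_contra hlt
  rw [not_le] at hlt
  have := mul_lt_one_of_lt_of_le hlt h2
  rw [hv] at this
  exact lt_irrefl _ this

/-- translating a coset by an element commuting with `K` does not change the number of cosets in its `K`-orbit. [cite: ShimuraIATAF1971, Prop. 3.17] -/
theorem orbit_mk_mul_eq_image {G : Type*} [Group G] (K : Subgroup G) {z : G} (hz : ∀ κ ∈ K, κ * z = z * κ) (g : G) :
    orbit K ((z * g : G) : G ⧸ K) = (fun γ : G ⧸ K => z • γ) '' orbit K (g : G ⧸ K) := by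
  ext γ
  simp only [Set.mem_image, mem_orbit_mk_iff]
  constructor
  · rintro ⟨κ, rfl⟩
    refine ⟨(((κ : G) * g : G) : G ⧸ K), ⟨κ, rfl⟩, ?_⟩
    rw [MulAction.Quotient.smul_mk, smul_eq_mul, ← mul_assoc, ← hz κ κ.2, mul_assoc]
  · rintro ⟨γ', ⟨κ, rfl⟩, rfl⟩
    refine ⟨κ, ?_⟩
    rw [MulAction.Quotient.smul_mk, smul_eq_mul, ← mul_assoc, hz κ κ.2, mul_assoc]

/-- `((q⁻¹)^N)^{s+1} = (q^{−(s+1)})^N` for a positive real base (complex powers of positive reals multiply).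
[cite: CasselsFrohlichANT1967, Ch. XV (Tate) §4.3] -/
theorem ofReal_inv_pow_cpow {q : ℕ} (hq : 0 < q) (N : ℕ) (z : ℂ) :
    ((((q : ℝ)⁻¹ ^ N : ℝ)) : ℂ) ^ z = ((q : ℂ) ^ (-z)) ^ N := by
  have hq0 : (q : ℂ) ≠ 0 := Nat.cast_ne_zero.2 hq.ne'
  have hcast : ((((q : ℝ)⁻¹ ^ N : ℝ)) : ℂ) = (q : ℂ) ^ (-(N : ℂ)) := by
    rw [Complex.cpow_neg, Complex.cpow_natCast, ← inv_pow]
    push_cast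
    rfl
  have him : (Complex.log (q : ℂ) * (-(N : ℂ))).im = 0 := by
    rw [show (q : ℂ) = ((q : ℝ) : ℂ) by norm_cast, ← Complex.ofReal_log (Nat.cast_nonneg q),
      show (-(N : ℂ)) = ((-(N : ℝ) : ℝ) : ℂ) by push_cast; ring, ← Complex.ofReal_mul, Complex.ofReal_im]
  rw [hcast, ← Complex.cpow_mul _ (by rw [him]; exact neg_lt_zero.2 Real.pi_pos) (by rw [him]; exact Real.pi_pos.le),
    ← Complex.cpow_nat_mul]
  congr 1
  ring

/-- the Cartan lattice of `GL₂` (antitone integer pairs) is `ℕ × ℤ` via `a ↦ (a₀ − a₁, a₁)`, `(k, j) ↦ (j + k, j)`.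
[cite: Macdonald1995, Ch. V §2] -/
theorem exists_antitoneEquiv : ∃ ε : {a : Fin 2 → ℤ // Antitone a} ≃ ℕ × ℤ,
    (∀ a, ε a = ((a.1 0 - a.1 1).toNat, a.1 1)) ∧ ∀ p, (ε.symm p).1 = ![p.2 + p.1, p.2] := by
  refine ⟨⟨fun a => ((a.1 0 - a.1 1).toNat, a.1 1), fun p => ⟨![p.2 + p.1, p.2], fun i j hij => ?_⟩, fun a => ?_, fun p => ?_⟩,
    fun a => rfl, fun p => rfl⟩
  · fin_cases i <;> fin_cases j <;> simp at hij ⊢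
  · have h := a.2 (show (0 : Fin 2) ≤ 1 from Fin.zero_le _)
    refine Subtype.ext (funext fun i => ?_)
    fin_cases i
    · simp only [Fin.zero_eta, Fin.isValue, Matrix.cons_val_zero]; omega
    · simp
  · refine Prod.ext ?_ rfl
    simp

/-- summability of the bound `q^{a₀−a₁} ρ^{|a₀|+|a₁|}` over the Cartan lattice for `qρ < 1`, `0 ≤ ρ`, `1 ≤ q` (three cones of
★ `exists_coneEquiv`, each a product of two geometric series). [cite: Macdonald1995, Ch. V §2 (2.9)] [cite: Li1992, §3] -/
theorem summable_cartan_bound {q ρ : ℝ} (hq : 1 ≤ q) (hρ0 : 0 ≤ ρ) (hρ : q * ρ < 1) :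
    Summable fun a : {a : Fin 2 → ℤ // Antitone a} =>
      q ^ (a.1 0 - a.1 1).toNat * ρ ^ (((a.1 0).toNat + (a.1 1).toNat) + ((-a.1 0).toNat + (-a.1 1).toNat)) := by
  obtain ⟨ε, hε, hεs⟩ := exists_antitoneEquiv
  obtain ⟨E, hE1, hE2, hE3⟩ := K2LiuCartanSeriesGL2.exists_coneEquiv
  have hq0 : 0 ≤ q := zero_le_one.trans hq
  have hqρ0 : 0 ≤ q * ρ := mul_nonneg hq0 hρ0
  have hρ1 : ρ < 1 := by nlinarith
  have hρ2 : ρ ^ 2 < 1 := by nlinarith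
  have g1 : Summable fun k : ℕ => (q * ρ) ^ k := summable_geometric_of_lt_one hqρ0 hρ
  have g2 : Summable fun k : ℕ => (ρ ^ 2) ^ k := summable_geometric_of_lt_one (sq_nonneg ρ) hρ2
  set f : {a : Fin 2 → ℤ // Antitone a} → ℝ := fun a =>
    q ^ (a.1 0 - a.1 1).toNat * ρ ^ (((a.1 0).toNat + (a.1 1).toNat) + ((-a.1 0).toNat + (-a.1 1).toNat)) with hf
  suffices h : Summable ((f ∘ ε.symm) ∘ E) by
    have h' := (E.summable_iff.1 h)
    exact ε.symm.summable_iff.1 h'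
  refine Summable.sum _ ?_ (Summable.sum _ ?_ ?_)
  · refine ((g1.mul_of_nonneg g2 (fun _ => pow_nonneg hqρ0 _) fun _ => pow_nonneg (sq_nonneg ρ) _)).congr fun p => ?_
    show (q * ρ) ^ p.1 * (ρ ^ 2) ^ p.2 = f (ε.symm (E (Sum.inl p)))
    rw [hE1, hf]
    simp only [hεs, Fin.isValue, Matrix.cons_val_zero, Matrix.cons_val_one]
    rw [show ((p.2 : ℤ) + (p.1 : ℕ) - (p.2 : ℤ)).toNat = p.1 by omega,
      show ((p.2 : ℤ) + (p.1 : ℕ)).toNat + (p.2 : ℤ).toNat + ((-((p.2 : ℤ) + (p.1 : ℕ))).toNat + (-(p.2 : ℤ)).toNat) = p.1 + 2 * p.2 by omega]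
    rw [mul_pow, ← pow_mul, pow_add]; ring
  · refine (((g1.mul_of_nonneg g1 (fun _ => pow_nonneg hqρ0 _) fun _ => pow_nonneg hqρ0 _)).mul_left (q * ρ)).congr fun p => ?_
    show q * ρ * ((q * ρ) ^ p.1 * (q * ρ) ^ p.2) = f (ε.symm (E (Sum.inr (Sum.inl p))))
    rw [hE2, hf]
    simp only [hεs, Fin.isValue, Matrix.cons_val_zero, Matrix.cons_val_one]
    rw [show (-((p.1 : ℤ) + 1) + ((p.2 + p.1 + 1 : ℕ) : ℤ) - (-((p.1 : ℤ) + 1))).toNat = p.2 + p.1 + 1 by omega,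
      show (-((p.1 : ℤ) + 1) + ((p.2 + p.1 + 1 : ℕ) : ℤ)).toNat + (-((p.1 : ℤ) + 1)).toNat +
        ((-(-((p.1 : ℤ) + 1) + ((p.2 + p.1 + 1 : ℕ) : ℤ))).toNat + (-(-((p.1 : ℤ) + 1))).toNat) = p.2 + p.1 + 1 by omega]
    rw [mul_pow]; ring
  · refine (((g1.mul_of_nonneg g2 (fun _ => pow_nonneg hqρ0 _) fun _ => pow_nonneg (sq_nonneg ρ) _)).mul_left (ρ ^ 2)).congr fun p => ?_
    show ρ ^ 2 * ((q * ρ) ^ p.1 * (ρ ^ 2) ^ p.2) = f (ε.symm (E (Sum.inr (Sum.inr p))))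
    rw [hE3, hf]
    simp only [hεs, Fin.isValue, Matrix.cons_val_zero, Matrix.cons_val_one]
    rw [show (-((p.1 : ℤ) + p.2 + 1) + (p.1 : ℕ) - (-((p.1 : ℤ) + p.2 + 1))).toNat = p.1 by omega,
      show (-((p.1 : ℤ) + p.2 + 1) + (p.1 : ℕ)).toNat + (-((p.1 : ℤ) + p.2 + 1)).toNat +
        ((-(-((p.1 : ℤ) + p.2 + 1) + (p.1 : ℕ))).toNat + (-(-((p.1 : ℤ) + p.2 + 1))).toNat) = p.1 + 2 * p.2 + 2 by omega]
    rw [mul_pow, ← pow_mul, pow_add, pow_add]; ring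

/-- eigenvalues along integer powers: if `τ(g) u = b • u` for a monoid hom `τ` into bounded operators and `u ≠ 0`, then `b ≠ 0` and
`τ(g^j) u = b^j • u` for every `j ∈ ℤ`. [cite: Li1992, §3] -/
theorem apply_zpow_eq_smul {G V : Type*} [Group G] [NormedAddCommGroup V] [NormedSpace ℂ V] (τ : G →* (V →L[ℂ] V)) {g : G} {u : V} {b : ℂ}
    (hg : τ g u = b • u) (hu : u ≠ 0) : b ≠ 0 ∧ ∀ j : ℤ, τ (g ^ j) u = b ^ j • u := by
  have hpow : ∀ (g : G) (b : ℂ), τ g u = b • u → ∀ m : ℕ, τ (g ^ m) u = b ^ m • u := by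
    intro g b hg m
    induction m with
    | zero => rw [pow_zero, pow_zero, map_one, one_smul]; rfl
    | succ m ih =>
      rw [pow_succ, map_mul]
      change τ (g ^ m) (τ g u) = _
      rw [hg, map_smul, ih, smul_smul, pow_succ, mul_comm]
  have hinv0 : τ g⁻¹ (τ g u) = u := by
    change (τ g⁻¹ * τ g) u = u
    rw [← map_mul, inv_mul_cancel, map_one]; rfl
  have hb : b ≠ 0 := by
    intro h0
    apply hu
    have h := hinv0
    rw [hg, h0, zero_smul, map_zero] at h
    exact h.symm
  have hinv : τ g⁻¹ u = b⁻¹ • u := by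
    have h := hinv0
    rw [hg, map_smul] at h
    calc τ g⁻¹ u = b⁻¹ • (b • τ g⁻¹ u) := by rw [smul_smul, inv_mul_cancel₀ hb, one_smul]
      _ = b⁻¹ • u := by rw [h]
  refine ⟨hb, fun j => ?_⟩
  obtain ⟨m, rfl | rfl⟩ := Int.eq_nat_or_neg j
  · rw [zpow_natCast, zpow_natCast, hpow g b hg m]
  · rw [_root_.zpow_neg, zpow_natCast, _root_.zpow_neg, zpow_natCast, ← inv_pow, ← inv_pow, hpow g⁻¹ b⁻¹ hinv m]

end Summit.HodgeConjecture.HodgeConjecture.Cruxes.HLiu418.K2LiuUnramifiedDoublingHeckePrelims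

end
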